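import Mathlib
import HarnessLib.Audit
import Summits.PneNP.PneNP.Theorems.PstarChordReadHubCalc

/-!
# The hub two-chord theorem, core: the two normalised type patterns (ROUND-24, O1 beyond tightness; memo g22 §23)

FRONTIER range-avoidance ladder, rung F-N3, ROUND 24 (cell `pnp-ideate`, prover-2 memo `g22/O1-PAIRCORE-g22.md` §23; typed target
`PstarCoreBoundTargets.TerminalPeelable` (p646951); restricted-model proof complexity — nothing here bears on `P` versus `NP`).

Two slice-generic chords `cᵢ ≠ cⱼ` (privates `vᵢ, vⱼ`, co-privates `vᵢ', vⱼ'`) of a terminal core, gated on ONE common outside variable `z` — a HUB,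
the configuration excluded by hypothesis in `PstarChordReadTwoChords.false_of_two_gated` and affordable from boundary slack two on.  The data are
abstracted in `HubData`: the chords, `z` outside, the `z`-free menu avoiding both AND pairs, slice genericity, no cross monomial `{vᵢ, vⱼ}`, and
the MOVES of `vᵢ, vⱼ, z` under both readers as Boolean formulas `mvₖ vᵢ = lᵢₖ ⊕ tᵢₖ·x_z`, `mvₖ vⱼ = lⱼₖ ⊕ tⱼₖ·x_z`,
`mvₖ z = eₖ ⊕ tᵢₖ·x_{vᵢ} ⊕ tⱼₖ·x_{vⱼ}` (the pure hub; `PstarChordReadGates.coef_switch`, `PstarChordReadSharedTypes.coef_switch₂`).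

* `HubData.rank_one_hub` — the two private flips commute: (R1) `lᵢ₁lⱼ₂ = lⱼ₁lᵢ₂` at `x_z = 0`, (R2) the same with `l ↦ l ⊕ t` at `x_z = 1`
  (`PstarChordReadFlip.rank_one` at double-slice points, `exists_base`);
* `HubData.clᵢ₂` … `HubData.clⱼS` — directions `(1,0)`, `(0,1)`, `(1,1)` of a private on `{x_z = κ}` make `Γ₂|_κ`, `Γ₁|_κ`, `(Γ₁⊕Γ₂)|_κ`
  chord-local there (`PstarChordReadHubLocal`);
* **`HubData.false_of_mixed`** — gate types `tᵢ = (1,0)`, `tⱼ = (0,1)`: dead; **`HubData.false_of_uniform`** — `tᵢ = tⱼ = (1,0)`: dead.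
  In every branch both readers become LOCAL on a hyperplane (`PstarChordReadHubCalc`), hence bi-chord-local, and
  `PstarChordReadBiLocal.false_of_biLocal₂` ends it; the uniform blind branch uses two-locality of `Γ₂` and `gSat` for `Γ₁|_{z := ζ}`.

The other seven type patterns reduce to these by `terminal_symm` / `terminal_sum`; the instance-level capstone deriving `HubData` from two outside
gates on a common partner is the sequel.  No Assumption A.
-/

set_option linter.dupNamespace false -- `Summit.PneNP.PneNP.…`: summit = sub-problem name (D-0017 single-conjunct layout)

open Finset Literature.Computability.Complexity
open scoped symmDiff
open Summit.PneNP.PneNP.Theorems.PstarTyped (Typed)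
open Summit.PneNP.PneNP.Theorems.PstarSALevel (varSet bdry BoundaryExpanding SimpleOverlap)
open Summit.PneNP.PneNP.Theorems.PstarGapPeeling (not_mem_varSet_of_private)
open Summit.PneNP.PneNP.Theorems.PstarCentreFree (vars_mem_varSet)
open Summit.PneNP.PneNP.Theorems.PstarGapOneAll (gval)
open Summit.PneNP.PneNP.Theorems.PstarGSat (gSat)
open Summit.PneNP.PneNP.Theorems.PstarChordRepair (IsChord)
open Summit.PneNP.PneNP.Theorems.PstarCoreBoundTargets (Terminal)
open Summit.PneNP.PneNP.Theorems.PstarChordReadLemma (ChordLocal SliceGeneric)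
open Summit.PneNP.PneNP.Theorems.PstarChordReadSwitch (solves_update_of_outside false_of_gval₂_const)
open Summit.PneNP.PneNP.Theorems.PstarChordReadGates (sliceGeneric_mono exists_two_slices)
open Summit.PneNP.PneNP.Theorems.PstarChordReadTwoGates (exists_xor_not_mem_of_simpleOverlap)
open Summit.PneNP.PneNP.Theorems.PstarChordReadFlip (mv rank_one solves_update_priv)
open Summit.PneNP.PneNP.Theorems.PstarChordReadRestrictVar (avoid avoid_subset avoid_spec restrict1 restrict1_snd_subset gval_restrict1)
open Summit.PneNP.PneNP.Theorems.PstarChordReadBiLocal (BiChordLocal false_of_biLocal₂)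
open Summit.PneNP.PneNP.Theorems.PstarChordReadHubLocal
open Summit.PneNP.PneNP.Theorems.PstarChordReadHubCalc

namespace Summit.PneNP.PneNP.Theorems.PstarChordReadHubCore

variable {n m : ℕ}

/-- **HUB DATA**: two chords `cᵢ ≠ cⱼ` of `J₀` (AND pairs `(vᵢ, vᵢ')`, `(vⱼ, vⱼ')`), an outside variable `z`, the `z`-free part of the menu avoiding
both AND pairs, slice genericity of both chords, no cross monomial, and the moves of `vᵢ, vⱼ, z` under the readers `w₁, w₂` in hub form. -/
structure HubData (I : LocalMap 4 n m) (y : Fin m → Bool) (J₀ : Finset (Fin m)) (w₁ w₂ : Finset (Fin n) × Finset (Fin m) × Bool)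
    (cᵢ cⱼ : Fin m) (vᵢ vᵢ' vⱼ vⱼ' z : Fin n) (lᵢ₁ lᵢ₂ lⱼ₁ lⱼ₂ tᵢ₁ tᵢ₂ tⱼ₁ tⱼ₂ e₁ e₂ : Bool) : Prop where
  /-- `cᵢ ∈ J₀` -/
  memᵢ : cᵢ ∈ J₀
  /-- `cⱼ ∈ J₀` -/
  memⱼ : cⱼ ∈ J₀
  /-- distinct chords -/
  ne : cᵢ ≠ cⱼ
  /-- `cᵢ` is a chord -/
  chordᵢ : IsChord I J₀ cᵢ
  /-- `cⱼ` is a chord -/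
  chordⱼ : IsChord I J₀ cⱼ
  /-- AND pair of `cᵢ` -/
  pairᵢ : (I.vars cᵢ 2 = vᵢ ∧ I.vars cᵢ 3 = vᵢ') ∨ (I.vars cᵢ 2 = vᵢ' ∧ I.vars cᵢ 3 = vᵢ)
  /-- AND pair of `cⱼ` -/
  pairⱼ : (I.vars cⱼ 2 = vⱼ ∧ I.vars cⱼ 3 = vⱼ') ∨ (I.vars cⱼ 2 = vⱼ' ∧ I.vars cⱼ 3 = vⱼ)
  /-- `z` outside the core -/
  out : ∀ j ∈ J₀, z ∉ varSet I j
  /-- the `z`-free menu avoids the AND pair of `cᵢ` -/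
  monoᵢ : ∀ g ∈ avoid I (w₁.2.1 ∪ w₂.2.1) z,
    (I.vars g 2 ≠ I.vars cᵢ 2 ∧ I.vars g 3 ≠ I.vars cᵢ 2) ∧ (I.vars g 2 ≠ I.vars cᵢ 3 ∧ I.vars g 3 ≠ I.vars cᵢ 3)
  /-- the `z`-free menu avoids the AND pair of `cⱼ` -/
  monoⱼ : ∀ g ∈ avoid I (w₁.2.1 ∪ w₂.2.1) z,
    (I.vars g 2 ≠ I.vars cⱼ 2 ∧ I.vars g 3 ≠ I.vars cⱼ 2) ∧ (I.vars g 2 ≠ I.vars cⱼ 3 ∧ I.vars g 3 ≠ I.vars cⱼ 3)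
  /-- `cᵢ` slice-generic -/
  genᵢ : SliceGeneric I y J₀ cᵢ (w₁.2.1 ∪ w₂.2.1)
  /-- `cⱼ` slice-generic -/
  genⱼ : SliceGeneric I y J₀ cⱼ (w₁.2.1 ∪ w₂.2.1)
  /-- no cross monomial `{vᵢ, vⱼ}` -/
  ncross : ∀ h ∈ w₁.2.1 ∪ w₂.2.1, ¬ ((I.vars h 2 = vⱼ ∧ I.vars h 3 = vᵢ) ∨ (I.vars h 2 = vᵢ ∧ I.vars h 3 = vⱼ))
  /-- move of `vᵢ` under `Γ₁` -/
  mvᵢ₁ : ∀ x : Fin n → Bool, mv I w₁.1 w₁.2.1 vᵢ x = xor lᵢ₁ (tᵢ₁ && x z)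
  /-- move of `vᵢ` under `Γ₂` -/
  mvᵢ₂ : ∀ x : Fin n → Bool, mv I w₂.1 w₂.2.1 vᵢ x = xor lᵢ₂ (tᵢ₂ && x z)
  /-- move of `vⱼ` under `Γ₁` -/
  mvⱼ₁ : ∀ x : Fin n → Bool, mv I w₁.1 w₁.2.1 vⱼ x = xor lⱼ₁ (tⱼ₁ && x z)
  /-- move of `vⱼ` under `Γ₂` -/
  mvⱼ₂ : ∀ x : Fin n → Bool, mv I w₂.1 w₂.2.1 vⱼ x = xor lⱼ₂ (tⱼ₂ && x z)
  /-- move of `z` under `Γ₁` -/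
  mvz₁ : ∀ x : Fin n → Bool, mv I w₁.1 w₁.2.1 z x = xor e₁ (xor (tᵢ₁ && x vᵢ) (tⱼ₁ && x vⱼ))
  /-- move of `z` under `Γ₂` -/
  mvz₂ : ∀ x : Fin n → Bool, mv I w₂.1 w₂.2.1 z x = xor e₂ (xor (tᵢ₂ && x vᵢ) (tⱼ₂ && x vⱼ))

namespace HubData

variable {I : LocalMap 4 n m} {r : ℕ} {y : Fin m → Bool} {J₀ : Finset (Fin m)} {w₁ w₂ : Finset (Fin n) × Finset (Fin m) × Bool}
  {cᵢ cⱼ : Fin m} {vᵢ vᵢ' vⱼ vⱼ' z : Fin n} {lᵢ₁ lᵢ₂ lⱼ₁ lⱼ₂ tᵢ₁ tᵢ₂ tⱼ₁ tⱼ₂ e₁ e₂ : Bool}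
  (H : HubData I y J₀ w₁ w₂ cᵢ cⱼ vᵢ vᵢ' vⱼ vⱼ' z lᵢ₁ lᵢ₂ lⱼ₁ lⱼ₂ tᵢ₁ tᵢ₂ tⱼ₁ tⱼ₂ e₁ e₂)
include H

/-! ### Bookkeeping -/

/-- `z` is not a variable of `cᵢ`. -/
theorem zᵢ : z ∉ varSet I cᵢ := H.out cᵢ H.memᵢ
/-- `z` is not a variable of `cⱼ`. -/
theorem zⱼ : z ∉ varSet I cⱼ := H.out cⱼ H.memⱼ

/-- The AND pair of `cᵢ` lies in `varSet cᵢ` and `vᵢ` is a boundary variable. -/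
theorem memvᵢ : vᵢ ∈ varSet I cᵢ ∧ vᵢ' ∈ varSet I cᵢ ∧ vᵢ ∈ bdry I J₀ := by
  rcases H.pairᵢ with ⟨h2, h3⟩ | ⟨h2, h3⟩
  · exact ⟨h2 ▸ vars_mem_varSet I cᵢ 2, h3 ▸ vars_mem_varSet I cᵢ 3, h2 ▸ H.chordᵢ.1⟩
  · exact ⟨h3 ▸ vars_mem_varSet I cᵢ 3, h2 ▸ vars_mem_varSet I cᵢ 2, h3 ▸ H.chordᵢ.2⟩

/-- The AND pair of `cⱼ` lies in `varSet cⱼ` and `vⱼ` is a boundary variable. -/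
theorem memvⱼ : vⱼ ∈ varSet I cⱼ ∧ vⱼ' ∈ varSet I cⱼ ∧ vⱼ ∈ bdry I J₀ := by
  rcases H.pairⱼ with ⟨h2, h3⟩ | ⟨h2, h3⟩
  · exact ⟨h2 ▸ vars_mem_varSet I cⱼ 2, h3 ▸ vars_mem_varSet I cⱼ 3, h2 ▸ H.chordⱼ.1⟩
  · exact ⟨h3 ▸ vars_mem_varSet I cⱼ 3, h2 ▸ vars_mem_varSet I cⱼ 2, h3 ▸ H.chordⱼ.2⟩

/-- `vᵢ` is not a variable of `cⱼ`; in particular `vᵢ ≠ vⱼ`, `vᵢ ≠ vⱼ'`. -/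
theorem vᵢ_not_mem : vᵢ ∉ varSet I cⱼ := not_mem_varSet_of_private I H.memᵢ H.memⱼ H.ne.symm H.memvᵢ.2.2 H.memvᵢ.1

/-- **A double-slice point with prescribed `x_z`.** -/
theorem exists_base (hI : I.IsPure xorAndPred) (hS : SimpleOverlap I) (κ : Bool) :
    ∃ x : Fin n → Bool, (∀ j ∈ J₀, I.eval x j = y j) ∧ x vᵢ' = false ∧ x vⱼ' = false ∧ x z = κ := by
  classical
  have hv := exists_xor_not_mem_of_simpleOverlap hI hS H.ne
  obtain ⟨x, hx, h2ᵢ, h3ᵢ, h2ⱼ, h3ⱼ⟩ := exists_two_slices hI H.memᵢ H.memⱼ H.ne H.chordᵢ H.chordⱼ hv H.genᵢ false false false false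
  have hzᵢ : ∀ s, z ≠ I.vars cᵢ s := fun s e => H.zᵢ (e ▸ vars_mem_varSet I cᵢ s)
  have hzⱼ : ∀ s, z ≠ I.vars cⱼ s := fun s e => H.zⱼ (e ▸ vars_mem_varSet I cⱼ s)
  refine ⟨Function.update x z κ, solves_update_of_outside H.out hx κ, ?_, ?_, Function.update_self ..⟩
  · rcases H.pairᵢ with ⟨-, h3⟩ | ⟨h2, -⟩
    · rw [← h3, Function.update_of_ne (hzᵢ 3).symm]; exact h3ᵢ
    · rw [← h2, Function.update_of_ne (hzᵢ 2).symm]; exact h2ᵢ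
  · rcases H.pairⱼ with ⟨-, h3⟩ | ⟨h2, -⟩
    · rw [← h3, Function.update_of_ne (hzⱼ 3).symm]; exact h3ⱼ
    · rw [← h2, Function.update_of_ne (hzⱼ 2).symm]; exact h2ⱼ

/-- **RANK ONE for the two privates** at a double-slice point with `x_z = κ`. -/
theorem rank_one_hub (hI : I.IsPure xorAndPred) (hS : SimpleOverlap I) (ht : Terminal I r y J₀ w₁ w₂) (κ : Bool) :
    (xor lᵢ₁ (tᵢ₁ && κ) && xor lⱼ₂ (tⱼ₂ && κ)) = (xor lⱼ₁ (tⱼ₁ && κ) && xor lᵢ₂ (tᵢ₂ && κ)) := by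
  obtain ⟨x, hx, h0ᵢ, h0ⱼ, hxz⟩ := H.exists_base hI hS κ
  have hvv : vᵢ ≠ vⱼ := fun e => H.vᵢ_not_mem (e ▸ H.memvⱼ.1)
  have hvv' : vⱼ' ≠ vᵢ := fun e => H.vᵢ_not_mem (e ▸ H.memvⱼ.2.1)
  have hxu := solves_update_priv hI H.memᵢ H.chordᵢ H.pairᵢ hx h0ᵢ (!x vᵢ)
  have hxv := solves_update_priv hI H.memⱼ H.chordⱼ H.pairⱼ hx h0ⱼ (!x vⱼ)
  have hxuv := solves_update_priv hI H.memⱼ H.chordⱼ H.pairⱼ hxu (by rw [Function.update_of_ne hvv']; exact h0ⱼ) (!x vⱼ)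
  have R := rank_one hI ht hvv H.ncross hx hxu hxv hxuv
  rw [H.mvᵢ₁, H.mvⱼ₂, H.mvⱼ₁, H.mvᵢ₂, hxz] at R
  exact R

/-! ### Chord-locality of restricted readers from directions -/

omit H in
/-- `G₁ ∆ G₂ ⊆ G₁ ∪ G₂`. -/
private theorem sdiff_sub : w₁.2.1 ∆ w₂.2.1 ⊆ w₁.2.1 ∪ w₂.2.1 := by
  intro g hg
  rw [mem_symmDiff] at hg
  rcases hg with ⟨h, -⟩ | ⟨h, -⟩
  exacts [mem_union_left _ h, mem_union_right _ h]

/-- Direction `(1,0)` of `vᵢ` on `{x_z = κ}`: `Γ₂|_κ` is chord-local at `cᵢ`. -/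
theorem clᵢ₂ (hI : I.IsPure xorAndPred) (hS : SimpleOverlap I) (ht : Terminal I r y J₀ w₁ w₂) (κ : Bool)
    (h1 : xor lᵢ₁ (tᵢ₁ && κ) = true) (h2 : xor lᵢ₂ (tᵢ₂ && κ) = false) :
    ChordLocal I cᵢ (restrict1 I w₂.1 w₂.2.1 z κ).1 (restrict1 I w₂.1 w₂.2.1 z κ).2 :=
  chordLocal_restrict_of_fail hI hS H.memᵢ H.chordᵢ H.pairᵢ H.out (sliceGeneric_mono (avoid_subset I _ z) H.genᵢ) H.monoᵢ subset_union_right κ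
    w₂.2.2 fun x hx h0 hxz =>
      fail₂_of_dir10 hI ht H.memᵢ H.chordᵢ H.pairᵢ hx h0 (by rw [H.mvᵢ₁, hxz]; exact h1) (by rw [H.mvᵢ₂, hxz]; exact h2)

/-- Direction `(0,1)` of `vᵢ` on `{x_z = κ}`: `Γ₁|_κ` is chord-local at `cᵢ`. -/
theorem clᵢ₁ (hI : I.IsPure xorAndPred) (hS : SimpleOverlap I) (ht : Terminal I r y J₀ w₁ w₂) (κ : Bool)
    (h1 : xor lᵢ₁ (tᵢ₁ && κ) = false) (h2 : xor lᵢ₂ (tᵢ₂ && κ) = true) :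
    ChordLocal I cᵢ (restrict1 I w₁.1 w₁.2.1 z κ).1 (restrict1 I w₁.1 w₁.2.1 z κ).2 :=
  chordLocal_restrict_of_fail hI hS H.memᵢ H.chordᵢ H.pairᵢ H.out (sliceGeneric_mono (avoid_subset I _ z) H.genᵢ) H.monoᵢ subset_union_left κ
    w₁.2.2 fun x hx h0 hxz =>
      fail₁_of_dir01 hI ht H.memᵢ H.chordᵢ H.pairᵢ hx h0 (by rw [H.mvᵢ₁, hxz]; exact h1) (by rw [H.mvᵢ₂, hxz]; exact h2)

/-- Direction `(1,1)` of `vᵢ` on `{x_z = κ}`: `(Γ₁ ⊕ Γ₂)|_κ` is chord-local at `cᵢ`. -/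
theorem clᵢS (hI : I.IsPure xorAndPred) (hS : SimpleOverlap I) (ht : Terminal I r y J₀ w₁ w₂) (κ : Bool)
    (h1 : xor lᵢ₁ (tᵢ₁ && κ) = true) (h2 : xor lᵢ₂ (tᵢ₂ && κ) = true) :
    ChordLocal I cᵢ (restrict1 I (w₁.1 ∆ w₂.1) (w₁.2.1 ∆ w₂.2.1) z κ).1 (restrict1 I (w₁.1 ∆ w₂.1) (w₁.2.1 ∆ w₂.2.1) z κ).2 :=
  chordLocal_restrict_of_fail hI hS H.memᵢ H.chordᵢ H.pairᵢ H.out (sliceGeneric_mono (avoid_subset I _ z) H.genᵢ) H.monoᵢ sdiff_sub κ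
    (xor w₁.2.2 w₂.2.2) fun x hx h0 hxz =>
      failSum_of_dir11 hI ht H.memᵢ H.chordᵢ H.pairᵢ hx h0 (by rw [H.mvᵢ₁, hxz]; exact h1) (by rw [H.mvᵢ₂, hxz]; exact h2)

/-- Direction `(1,0)` of `vⱼ` on `{x_z = κ}`: `Γ₂|_κ` is chord-local at `cⱼ`. -/
theorem clⱼ₂ (hI : I.IsPure xorAndPred) (hS : SimpleOverlap I) (ht : Terminal I r y J₀ w₁ w₂) (κ : Bool)
    (h1 : xor lⱼ₁ (tⱼ₁ && κ) = true) (h2 : xor lⱼ₂ (tⱼ₂ && κ) = false) :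
    ChordLocal I cⱼ (restrict1 I w₂.1 w₂.2.1 z κ).1 (restrict1 I w₂.1 w₂.2.1 z κ).2 :=
  chordLocal_restrict_of_fail hI hS H.memⱼ H.chordⱼ H.pairⱼ H.out (sliceGeneric_mono (avoid_subset I _ z) H.genⱼ) H.monoⱼ subset_union_right κ
    w₂.2.2 fun x hx h0 hxz =>
      fail₂_of_dir10 hI ht H.memⱼ H.chordⱼ H.pairⱼ hx h0 (by rw [H.mvⱼ₁, hxz]; exact h1) (by rw [H.mvⱼ₂, hxz]; exact h2)

/-- Direction `(0,1)` of `vⱼ` on `{x_z = κ}`: `Γ₁|_κ` is chord-local at `cⱼ`. -/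
theorem clⱼ₁ (hI : I.IsPure xorAndPred) (hS : SimpleOverlap I) (ht : Terminal I r y J₀ w₁ w₂) (κ : Bool)
    (h1 : xor lⱼ₁ (tⱼ₁ && κ) = false) (h2 : xor lⱼ₂ (tⱼ₂ && κ) = true) :
    ChordLocal I cⱼ (restrict1 I w₁.1 w₁.2.1 z κ).1 (restrict1 I w₁.1 w₁.2.1 z κ).2 :=
  chordLocal_restrict_of_fail hI hS H.memⱼ H.chordⱼ H.pairⱼ H.out (sliceGeneric_mono (avoid_subset I _ z) H.genⱼ) H.monoⱼ subset_union_left κ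
    w₁.2.2 fun x hx h0 hxz =>
      fail₁_of_dir01 hI ht H.memⱼ H.chordⱼ H.pairⱼ hx h0 (by rw [H.mvⱼ₁, hxz]; exact h1) (by rw [H.mvⱼ₂, hxz]; exact h2)

/-- Direction `(1,1)` of `vⱼ` on `{x_z = κ}`: `(Γ₁ ⊕ Γ₂)|_κ` is chord-local at `cⱼ`. -/
theorem clⱼS (hI : I.IsPure xorAndPred) (hS : SimpleOverlap I) (ht : Terminal I r y J₀ w₁ w₂) (κ : Bool)
    (h1 : xor lⱼ₁ (tⱼ₁ && κ) = true) (h2 : xor lⱼ₂ (tⱼ₂ && κ) = true) :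
    ChordLocal I cⱼ (restrict1 I (w₁.1 ∆ w₂.1) (w₁.2.1 ∆ w₂.2.1) z κ).1 (restrict1 I (w₁.1 ∆ w₂.1) (w₁.2.1 ∆ w₂.2.1) z κ).2 :=
  chordLocal_restrict_of_fail hI hS H.memⱼ H.chordⱼ H.pairⱼ H.out (sliceGeneric_mono (avoid_subset I _ z) H.genⱼ) H.monoⱼ sdiff_sub κ
    (xor w₁.2.2 w₂.2.2) fun x hx h0 hxz =>
      failSum_of_dir11 hI ht H.memⱼ H.chordⱼ H.pairⱼ hx h0 (by rw [H.mvⱼ₁, hxz]; exact h1) (by rw [H.mvⱼ₂, hxz]; exact h2)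

/-! ### The endgame -/

/-- **Both readers local on some hyperplane ⟹ contradiction** (bi-locality + a third output). -/
theorem false_of_local (hI : I.IsPure xorAndPred) (hS : SimpleOverlap I) (ht : Terminal I r y J₀ w₁ w₂) {f : Fin m} (hf : f ∈ J₀)
    (hfᵢ : f ≠ cᵢ) (hfⱼ : f ≠ cⱼ) {κ₁ κ₂ : Bool} (h₁ : LocalAt I cᵢ cⱼ z κ₁ w₁.1 w₁.2.1) (h₂ : LocalAt I cᵢ cⱼ z κ₂ w₂.1 w₂.2.1) : False :=
  false_of_biLocal₂ hI ht H.memᵢ H.memⱼ H.ne H.chordᵢ H.chordⱼ (exists_xor_not_mem_of_simpleOverlap hI hS H.ne) H.genᵢ hf hfᵢ hfⱼ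
    (biChordLocal_of_localAt H.pairᵢ H.pairⱼ hI H.out h₁ (fun a b => xor e₁ (xor (tᵢ₁ && a) (tⱼ₁ && b))) H.mvz₁)
    (biChordLocal_of_localAt H.pairᵢ H.pairⱼ hI H.out h₂ (fun a b => xor e₂ (xor (tᵢ₂ && a) (tⱼ₂ && b))) H.mvz₂)

end HubData

/-! ## The two normalised type patterns -/
section Cases

variable {I : LocalMap 4 n m} {r : ℕ} {y : Fin m → Bool} {J₀ : Finset (Fin m)} {w₁ w₂ : Finset (Fin n) × Finset (Fin m) × Bool}
  {cᵢ cⱼ f : Fin m} {vᵢ vᵢ' vⱼ vⱼ' z : Fin n} {lᵢ₁ lᵢ₂ lⱼ₁ lⱼ₂ e₁ e₂ : Bool}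

/-- **MIXED TYPES `tᵢ = (1,0)`, `tⱼ = (0,1)`**: a pure hub is impossible. -/
theorem false_of_hub_mixed (hI : I.IsPure xorAndPred) (hS : SimpleOverlap I) (ht : Terminal I r y J₀ w₁ w₂)
    (H : HubData I y J₀ w₁ w₂ cᵢ cⱼ vᵢ vᵢ' vⱼ vⱼ' z lᵢ₁ lᵢ₂ lⱼ₁ lⱼ₂ true false false true e₁ e₂) (hf : f ∈ J₀) (hfᵢ : f ≠ cᵢ)
    (hfⱼ : f ≠ cⱼ) : False := by
  have R1 := H.rank_one_hub hI hS ht false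
  have R2 := H.rank_one_hub hI hS ht true
  simp only [Bool.and_false, Bool.xor_false, Bool.and_true] at R1 R2
  have Fz₁ := H.mvz₁
  have Fz₂ := H.mvz₂
  -- locality of `Γ₂`
  have L₂ : ∃ κ, LocalAt I cᵢ cⱼ z κ w₂.1 w₂.2.1 := by
    cases hl : lᵢ₂
    · refine ⟨!lᵢ₁, localAt_of_chordLocalᵢ hI hS (H.clᵢ₂ hI hS ht (!lᵢ₁) ?_ ?_)⟩
      · cases lᵢ₁ <;> rfl
      · rw [hl]; rfl
    · rw [hl] at R1 R2
      have hⱼ₁ : lⱼ₁ = false := by revert R1 R2; cases lᵢ₁ <;> cases lⱼ₁ <;> cases lⱼ₂ <;> decide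
      have hrel : lⱼ₂ = !lᵢ₁ := by revert R1 R2; rw [hⱼ₁]; cases lᵢ₁ <;> cases lⱼ₂ <;> decide
      -- `Γ₁|_{lᵢ₁}` chord-local at both chords
      have cᵢ' := H.clᵢ₁ hI hS ht lᵢ₁ (by cases lᵢ₁ <;> rfl) (by rw [hl]; rfl)
      have cⱼ' := H.clⱼ₁ hI hS ht lᵢ₁ (by rw [hⱼ₁]; rfl) (by rw [hrel]; cases lᵢ₁ <;> rfl)
      have const₁ := const_on_hyperplane_of_two_chordLocal hI hS H.memᵢ H.memⱼ H.ne H.chordᵢ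
        (exists_xor_not_mem_of_simpleOverlap hI hS H.ne) cᵢ' cⱼ'
      have Lc : LocalAt I cᵢ cⱼ z (!lᵢ₁) w₁.1 w₁.2.1 :=
        localAt_shift H.pairᵢ H.pairⱼ H.zᵢ H.zⱼ hI (localAt_of_const const₁) (fun a b => xor e₁ (xor (true && a) (false && b))) Fz₁
      have cS := H.clᵢS hI hS ht (!lᵢ₁) (by cases lᵢ₁ <;> rfl) (by rw [hl]; rfl)
      exact ⟨!lᵢ₁, localAt₂_of_localAt₁_sum Lc (localAt_of_chordLocalᵢ hI hS cS)⟩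
  -- locality of `Γ₁`
  have L₁ : ∃ κ, LocalAt I cᵢ cⱼ z κ w₁.1 w₁.2.1 := by
    cases hl : lⱼ₁
    · refine ⟨!lⱼ₂, localAt_of_chordLocalⱼ hI hS (H.clⱼ₁ hI hS ht (!lⱼ₂) ?_ ?_)⟩
      · rw [hl]; rfl
      · cases lⱼ₂ <;> rfl
    · rw [hl] at R1 R2
      have hᵢ₂ : lᵢ₂ = false := by revert R1 R2; cases lᵢ₁ <;> cases lᵢ₂ <;> cases lⱼ₂ <;> decide
      have hrel : lⱼ₂ = !lᵢ₁ := by revert R1 R2; rw [hᵢ₂]; cases lᵢ₁ <;> cases lⱼ₂ <;> decide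
      -- `Γ₂|_{!lᵢ₁}` chord-local at both chords
      have cᵢ' := H.clᵢ₂ hI hS ht (!lᵢ₁) (by cases lᵢ₁ <;> rfl) (by rw [hᵢ₂]; rfl)
      have cⱼ' := H.clⱼ₂ hI hS ht (!lᵢ₁) (by rw [hl]; rfl) (by rw [hrel]; cases lᵢ₁ <;> rfl)
      have const₂ := const_on_hyperplane_of_two_chordLocal hI hS H.memᵢ H.memⱼ H.ne H.chordᵢ
        (exists_xor_not_mem_of_simpleOverlap hI hS H.ne) cᵢ' cⱼ'
      have Lc : LocalAt I cᵢ cⱼ z lᵢ₁ w₂.1 w₂.2.1 :=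
        localAt_shift H.pairᵢ H.pairⱼ H.zᵢ H.zⱼ hI (localAt_of_const const₂) (fun a b => xor e₂ (xor (false && a) (true && b))) Fz₂
      have cS := H.clⱼS hI hS ht lᵢ₁ (by rw [hl]; rfl) (by rw [hrel]; cases lᵢ₁ <;> rfl)
      exact ⟨lᵢ₁, localAt₁_of_localAt₂_sum Lc (localAt_of_chordLocalⱼ hI hS cS)⟩
  obtain ⟨κ₁, h₁⟩ := L₁
  obtain ⟨κ₂, h₂⟩ := L₂
  exact H.false_of_local hI hS ht hf hfᵢ hfⱼ h₁ h₂

/-- **UNIFORM TYPES `tᵢ = tⱼ = (1,0)`**: a pure hub is impossible. -/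
theorem false_of_hub_uniform (hI : I.IsPure xorAndPred) (hT : Typed I) (hS : SimpleOverlap I) (hB : BoundaryExpanding r I)
    (ht : Terminal I r y J₀ w₁ w₂) (H : HubData I y J₀ w₁ w₂ cᵢ cⱼ vᵢ vᵢ' vⱼ vⱼ' z lᵢ₁ lᵢ₂ lⱼ₁ lⱼ₂ true false true false e₁ e₂)
    (hf : f ∈ J₀) (hfᵢ : f ≠ cᵢ) (hfⱼ : f ≠ cⱼ) : False := by
  classical
  have R1 := H.rank_one_hub hI hS ht false
  simp only [Bool.and_false, Bool.xor_false] at R1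
  have Fz₁ := H.mvz₁
  have Fz₂ := H.mvz₂
  have hv := exists_xor_not_mem_of_simpleOverlap hI hS H.ne
  by_cases hblind : lᵢ₂ = false ∧ lⱼ₂ = false
  · -- (U-a) `Γ₂` blind to both privates: `Γ₂|_κ` chord-local at both chords (same `κ` after a constant shift)
    obtain ⟨hᵢ₂, hⱼ₂⟩ := hblind
    have cᵢ' := H.clᵢ₂ hI hS ht (!lᵢ₁) (by cases lᵢ₁ <;> rfl) (by rw [hᵢ₂]; rfl)
    have cⱼ'' := H.clⱼ₂ hI hS ht (!lⱼ₁) (by cases lⱼ₁ <;> rfl) (by rw [hⱼ₂]; rfl)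
    -- transport `cⱼ''` to the hyperplane `!lᵢ₁`: the move of `z` under `Γ₂` is the constant `e₂`
    have hmz : ∀ x : Fin n → Bool, mv I w₂.1 w₂.2.1 z x = e₂ := fun x => by rw [Fz₂]; simp
    have cⱼ' : ChordLocal I cⱼ (restrict1 I w₂.1 w₂.2.1 z (!lᵢ₁)).1 (restrict1 I w₂.1 w₂.2.1 z (!lᵢ₁)).2 := by
      obtain ⟨ψ, hψ⟩ := cⱼ''
      refine ⟨fun s p q => xor (xor (xor (ψ s p q) (!lⱼ₁ && decide (z ∈ w₂.1))) (xor (!lᵢ₁) (!lⱼ₁) && e₂)) (!lᵢ₁ && decide (z ∈ w₂.1)),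
        fun x => ?_⟩
      have e := hψ x
      rw [gval_restrict1 I hI hS] at e ⊢
      rw [gval_eq_restrict_xor hI w₂.1 w₂.2.1 z (!lⱼ₁) (Function.update x z (!lᵢ₁)), Function.update_idem, Function.update_self,
        PstarChordReadFlip.mv_update_self I w₂.1 w₂.2.1 hI, hmz]
      beta_reduce
      rw [← e]
      cases gval I w₂.1 w₂.2.1 (Function.update x z !lⱼ₁) <;> cases (!lⱼ₁ && decide (z ∈ w₂.1)) <;> cases (!lᵢ₁ && decide (z ∈ w₂.1)) <;>
        cases (xor (!lᵢ₁) (!lⱼ₁) && e₂) <;> decide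
    have const₂ := const_on_hyperplane_of_two_chordLocal hI hS H.memᵢ H.memⱼ H.ne H.chordᵢ hv cᵢ' cⱼ'
    -- `Γ₂(x) = c₀ ⊕ (x_z ⊕ κ)·e₂`
    have form₂ : ∀ x : Fin n → Bool, gval I w₂.1 w₂.2.1 x = xor (!lᵢ₁ && decide (z ∈ w₂.1)) (xor (x z) (!lᵢ₁) && e₂) := fun x => by
      rw [gval_eq_restrict_xor hI w₂.1 w₂.2.1 z (!lᵢ₁) x, const₂ _ (Function.update_self ..), hmz]
    cases he : e₂
    · -- `Γ₂` constant
      exact false_of_gval₂_const hI hT hS hB ht fun x x' => by rw [form₂, form₂, he]; simp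
    · -- `Γ₂ = b₂` pins `x_z = ζ`; then `Γ₁|_ζ` is constant by `gSat`
      set ζ : Bool := xor (xor (!lᵢ₁ && decide (z ∈ w₂.1)) w₂.2.2) (!lᵢ₁) with hζ
      have pin : ∀ x : Fin n → Bool, gval I w₂.1 w₂.2.1 x = w₂.2.2 ↔ x z = ζ := fun x => by
        rw [form₂, he, hζ]
        cases x z <;> cases lᵢ₁ <;> cases decide (z ∈ w₂.1) <;> cases w₂.2.2 <;> decide
      set R := restrict1 I w₁.1 w₁.2.1 z ζ with hR
      have hRconst : ∀ u u' : Fin n → Bool, gval I R.1 R.2 u = gval I R.1 R.2 u' := by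
        by_contra hnc
        push Not at hnc
        obtain ⟨u, u', huu⟩ := hnc
        have hdisj : Disjoint J₀ R.2 := ht.2.2.2.1.mono_right (restrict1_snd_subset I _ _ z ζ)
        obtain ⟨x, hx, hxR⟩ := gSat n m r I hI hT hB hS y J₀ R.2 R.1 (xor w₁.2.2 (ζ && decide (z ∈ w₁.1))) ht.2.2.1.le hdisj ⟨u, u', huu⟩
        rw [hR, gval_restrict1 I hI hS] at hxR
        have h₁ : gval I w₁.1 w₁.2.1 (Function.update x z ζ) = w₁.2.2 := by
          revert hxR; cases gval I w₁.1 w₁.2.1 (Function.update x z ζ) <;> cases w₁.2.2 <;> cases (ζ && decide (z ∈ w₁.1)) <;> decide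
        have h₂ : gval I w₂.1 w₂.2.1 (Function.update x z ζ) = w₂.2.2 := (pin _).2 (Function.update_self ..)
        exact ht.2.2.2.2.2.2.1 ⟨_, solves_update_of_outside H.out hx ζ, h₁, h₂⟩
      have const₁ : ∀ x : Fin n → Bool, x z = ζ → gval I w₁.1 w₁.2.1 x = gval I w₁.1 w₁.2.1 (Function.update (fun _ => false) z ζ) := by
        intro x hxz
        have e := hRconst x (fun _ => false)
        rw [hR, gval_restrict1 I hI hS, gval_restrict1 I hI hS, show Function.update x z ζ = x by rw [← hxz, Function.update_eq_self]] at e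
        revert e
        cases gval I w₁.1 w₁.2.1 x <;> cases gval I w₁.1 w₁.2.1 (Function.update (fun _ => false) z ζ) <;>
          cases (ζ && decide (z ∈ w₁.1)) <;> decide
      exact H.false_of_local hI hS ht hf hfᵢ hfⱼ (localAt_of_const const₁) (localAt_of_chordLocalᵢ hI hS cᵢ')
  · -- some private is read linearly by `Γ₂`
    -- locality of `Γ₁`: direction `(0,1)` at the chord whose private `Γ₂` reads
    have L₁ : ∃ κ, LocalAt I cᵢ cⱼ z κ w₁.1 w₁.2.1 := by
      cases hᵢ : lᵢ₂
      · have hⱼ : lⱼ₂ = true := by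
          cases h : lⱼ₂
          · exact absurd ⟨hᵢ, h⟩ hblind
          · rfl
        exact ⟨lⱼ₁, localAt_of_chordLocalⱼ hI hS (H.clⱼ₁ hI hS ht lⱼ₁ (by cases lⱼ₁ <;> rfl) (by rw [hⱼ]; rfl))⟩
      · exact ⟨lᵢ₁, localAt_of_chordLocalᵢ hI hS (H.clᵢ₁ hI hS ht lᵢ₁ (by cases lᵢ₁ <;> rfl) (by rw [hᵢ]; rfl))⟩
    -- locality of `Γ₂`
    have L₂ : ∃ κ, LocalAt I cᵢ cⱼ z κ w₂.1 w₂.2.1 := by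
      cases hᵢ : lᵢ₂
      · exact ⟨!lᵢ₁, localAt_of_chordLocalᵢ hI hS (H.clᵢ₂ hI hS ht (!lᵢ₁) (by cases lᵢ₁ <;> rfl) (by rw [hᵢ]; rfl))⟩
      · cases hⱼ : lⱼ₂
        · exact ⟨!lⱼ₁, localAt_of_chordLocalⱼ hI hS (H.clⱼ₂ hI hS ht (!lⱼ₁) (by cases lⱼ₁ <;> rfl) (by rw [hⱼ]; rfl))⟩
        · -- (U-b): `lᵢ₁ = lⱼ₁`; `Γ₁|_{lᵢ₁}` chord-local at `cᵢ`, the sum at `!lᵢ₁`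
          rw [hᵢ, hⱼ] at R1
          simp only [Bool.and_true] at R1
          have c₁ := H.clᵢ₁ hI hS ht lᵢ₁ (by cases lᵢ₁ <;> rfl) (by rw [hᵢ]; rfl)
          have Lc : LocalAt I cᵢ cⱼ z (!lᵢ₁) w₁.1 w₁.2.1 :=
            localAt_shift H.pairᵢ H.pairⱼ H.zᵢ H.zⱼ hI (localAt_of_chordLocalᵢ hI hS c₁) (fun a b => xor e₁ (xor (true && a) (true && b))) Fz₁
          have cS := H.clᵢS hI hS ht (!lᵢ₁) (by cases lᵢ₁ <;> rfl) (by rw [hᵢ]; rfl)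
          exact ⟨!lᵢ₁, localAt₂_of_localAt₁_sum Lc (localAt_of_chordLocalᵢ hI hS cS)⟩
    obtain ⟨κ₁, h₁⟩ := L₁
    obtain ⟨κ₂, h₂⟩ := L₂
    exact H.false_of_local hI hS ht hf hfᵢ hfⱼ h₁ h₂

end Cases

end Summit.PneNP.PneNP.Theorems.PstarChordReadHubCore
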